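import Literature.AnabelianGeometry.SemiGraphs.CosetCategoriesSlim
import Literature.AnabelianGeometry.SemiGraphs.CosetCategoriesBridge
import Literature.AnabelianGeometry.SemiGraphs.TemperedCurves
import Literature.AlgebraicGeometry.Frobenioids.RigiditySlimness
import HarnessLib

/-!
# `𝓑^temp(Π)⁰` is a slim category for a tempered, temp-slim `Π` ([SemiAnbd] Rmk. 3.4.1; [FrdI] §0 p. 14)

Mochizuki, *Semi-graphs of anabelioids*, Publ. RIMS **42** (2006), §3, Remark 3.4.1 p. 36
[cite: MochizukiSemiAnbd2006, Rmk 3.4.1 p.36] ("a temperoid is slim as a category if and only if it is temp-slim");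
*The geometry of Frobenioids I*, §0 p. 14 [cite: MochizukiFrdI2008, §0 p.14] ("a category `C` is *slim* if the natural
functor `C_A → C` is rigid for every `A ∈ Ob(C)`"); *The étale theta function …*, Publ. RIMS **45** (2009), Thm. 3.7 /
Def. 4.1 / §5 [cite: MochizukiEtTh2009, Thm 3.7 p.303 (PDF p.77)]: the base category of the tempered Frobenioid is
`D := B^temp(Π^tp_X)⁰`, "a slim base category" — the hypothesis `IsSlim D` of the tree's Thm. 3.7 / Prop. 5.5 / Thm. 5.7
files, to be DISCHARGED at the genuine connected base `ConnectedPart (BTemp X.Pi)`.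

PROOF-ONLY (no definitions). Seat abc-iut-L2-d4 (gen 4), node `EtTh:Thm5.7` (binder `hslim` of
`Discharge/Sec5Thm57OfBiKummerFamily.lean` at abc-iut-L2-t4's genuine tower `ThetaFrobenioidTower.ofConnectedTemperoidFamily`).
* `Frobenioids.IsSlim.of_equivalence` — slimness of a category is transported along an equivalence `C ≌ D` (via
  Mathlib's `Over.post_forget_eq_forget_comp` and abc-iut-L1's `IsRigidFunctor.comp_of_isEquivalence`);
* `CosetCat.isSlim_of_forall_exists_lift` — Steps B–D of abc-iut-L1-t4's `CosetCat.isSlim_of_isSlimGroup` with its Step A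
  (the one place compactness was used) turned into a hypothesis;
* `CosetCat.exists_lift_of_forget_iso_of_isTempered` — Step A for a TEMPERED group: the compatible classes
  `α_{(Π/W, c)}(1·W)` come from one `ν ∈ Π` by `IsTempered.complete` (`Π = lim Π/N`) + `IsTempered.basis` in place of
  Cantor's intersection theorem;
* `CosetCat.isSlim_of_isSlimGroup_of_isTempered` — **`CosetCat Π` is slim for `Π` tempered and temp-slim**;
* `isSlim_connectedPart_bTemp` — **`𝓑^temp(Π)⁰ = ConnectedPart (BTemp Π)` is slim** (along abc-iut-L5-t2's
  `CosetCat.equivConnectedPart`); `TemperedArithmeticGroup.isSlim_connectedPart` — for `Π := Π^tp_X` of abc-iut-L3-t2's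
  interface ([SemiAnbd] Ex. 3.10: `Π` tempered and temp-slim).
Classical; nothing of the disputed series is asserted; no statement of the papers is strengthened.
-/

namespace Literature.AlgebraicGeometry.Frobenioids

open CategoryTheory

universe v₁ v₂ u₁ u₂

/-- **Slimness is invariant under equivalence of categories** ([FrdI] §0 p. 14): if `C` is slim and `e : C ≌ D`, then
`D` is slim — an automorphism of `D_A → D` whiskered with `e⁻¹` is an automorphism of `D_A → D → C = D_A → C_{e⁻¹A} → C`,
rigid as the precomposition of the rigid `C_{e⁻¹A} → C` with an equivalence; `e⁻¹` is faithful.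
[cite: MochizukiFrdI2008, §0 p.14] -/
theorem IsSlim.of_equivalence {C : Type u₁} [Category.{v₁} C] {D : Type u₂} [Category.{v₂} D] (e : C ≌ D)
    (h : IsSlim C) : IsSlim D := by
  refine ⟨fun A α => ?_⟩
  have hrig : IsRigidFunctor (Over.forget A ⋙ e.inverse) := by
    rw [← Over.post_forget_eq_forget_comp]
    exact IsRigidFunctor.comp_of_isEquivalence _ (h.isRigid_forget _)
  have hw := hrig (Functor.isoWhiskerRight α e.inverse)
  ext X
  apply e.inverse.map_injective
  have h1 := congrArg (fun γ : Over.forget A ⋙ e.inverse ≅ Over.forget A ⋙ e.inverse => γ.hom.app X) hw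
  simp only [Functor.isoWhiskerRight_hom, Functor.whiskerRight_app, Iso.refl_hom, NatTrans.id_app] at h1
  rw [h1, Iso.refl_hom, NatTrans.id_app, CategoryTheory.Functor.map_id]
  rfl

end Literature.AlgebraicGeometry.Frobenioids

namespace Literature.AnabelianGeometry.SemiGraphs

namespace CosetCat

open CategoryTheory Literature.AlgebraicGeometry.Frobenioids
open scoped Pointwise

universe u

variable {G : Type u} [Group G] [TopologicalSpace G]

/-- **Steps B–D of "`G` slim ⇒ `𝓑(G)⁰` slim"** ([FrdI] §0 p. 14) with Step A as a HYPOTHESIS `hlift` (for every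
automorphism `α` of `(CosetCat G)_A → CosetCat G` and point `c` with open stabiliser, the classes `α_{(G/W, c)}(1·W)`,
`W ⊆ Stab(c)` open, come from one `ν ∈ G`): if moreover the open subgroups separate points and have trivial centralisers,
`CosetCat G` is slim (verbatim the argument of `isSlim_of_isSlimGroup`: naturality along the twisted maps
`G/(W ∩ gWg⁻¹) → G/W` gives `gν = νg` on `Stab(c)`, so `ν = 1`). [cite: MochizukiFrdI2008, §0 p.14] -/
theorem isSlim_of_forall_exists_lift [IsTopologicalGroup G]
    (hsep : ∀ x : G, x ≠ 1 → ∃ W : OpenSubgroup G, x ∉ (W : Set G)) (hZ : IsSlimGroup G)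
    (hlift : ∀ {A : CosetCat G} (α : Over.forget A ≅ Over.forget A) (c : A.carrier) (W₀ : OpenSubgroup G),
      (∀ u ∈ W₀, u • c = c) → ∃ ν : G, ∀ (W : OpenSubgroup G) (hW : ∀ u ∈ W, u • c = c),
        pt (α.hom.app (Over.mk (homMk c hW : (⟨W⟩ : CosetCat G) ⟶ A))) = ((ν : G) : (⟨W⟩ : CosetCat G).carrier)) :
    IsSlim (CosetCat G) := by
  refine ⟨fun A α => ?_⟩
  suffices happ : ∀ O : Over A, α.hom.app O = 𝟙 _ by
    ext O
    rw [happ O, Iso.refl_hom, NatTrans.id_app]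
  intro O
  set c : A.carrier := pt O.hom with hc
  have hW₀ : ∀ u ∈ O.left.sg, u • c = c := fun u hu => smul_pt O.hom hu
  obtain ⟨ν, hν⟩ := hlift α c O.left.sg hW₀
  have hsep' : ∀ x : G, (∀ (W : OpenSubgroup G), (∀ u ∈ W, u • c = c) → x ∈ W) → x = 1 := by
    intro x hx
    by_contra hx1
    obtain ⟨W₁, hW₁⟩ := hsep x hx1
    exact hW₁ (OpenSubgroup.mem_inf.mp (hx (W₁ ⊓ O.left.sg)
      (fun u hu => hW₀ u (OpenSubgroup.mem_inf.mp hu).2))).1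
  -- Step B: `ν` commutes with every `g ∈ Stab(c)`
  have hcomm : ∀ g : G, g • c = c → g * ν = ν * g := by
    intro g hgc
    have key : ∀ (W : OpenSubgroup G), (∀ u ∈ W, u • c = c) → (ν * g)⁻¹ * (g * ν) ∈ W := by
      intro W hW
      let Wg : OpenSubgroup G := W.comap (MulAut.conj g⁻¹).toMonoidHom
        ((continuous_const.mul continuous_id).mul continuous_const)
      have hWg : ∀ u ∈ Wg, g⁻¹ * u * g ∈ W := fun u hu => by
        have hu' : (MulAut.conj g⁻¹) u ∈ W := hu
        rwa [MulAut.conj_apply, inv_inv] at hu'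
      let W' : OpenSubgroup G := W ⊓ Wg
      have hW' : ∀ u ∈ W', u • c = c := fun u hu => hW u (OpenSubgroup.mem_inf.mp hu).1
      have hfix : ∀ u ∈ (⟨W'⟩ : CosetCat G).sg,
          u • ((g : G) : (⟨W⟩ : CosetCat G).carrier) = ((g : G) : (⟨W⟩ : CosetCat G).carrier) :=
        fun u hu => (smul_coe_eq_coe_iff _ u g).mpr (hWg u (OpenSubgroup.mem_inf.mp hu).2)
      let kl : (⟨W'⟩ : CosetCat G) ⟶ ⟨W⟩ := homMk ((g : G) : (⟨W⟩ : CosetCat G).carrier) hfix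
      have hkw : kl ≫ (homMk c hW : (⟨W⟩ : CosetCat G) ⟶ A) = homMk c hW' :=
        hom_ext (by rw [pt_comp, pt_homMk, homMk_toFun_coe, hgc, pt_homMk])
      let k : Over.mk (homMk c hW' : (⟨W'⟩ : CosetCat G) ⟶ A) ⟶
          Over.mk (homMk c hW : (⟨W⟩ : CosetCat G) ⟶ A) :=
        Over.homMk kl hkw
      exact mem_of_smul_eq_coe (hν W hW) (forget_iso_relation α k g ν (pt_homMk _ hfix) (hν W' hW'))
    have h1 : (ν * g)⁻¹ * (g * ν) = 1 := hsep' _ key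
    rw [inv_mul_eq_one] at h1
    exact h1.symm
  -- Step C: `ν` centralises the open subgroup `Stab(c)`, hence `ν = 1`
  have hν1 : ν = 1 := by
    have hopen : IsOpen ((MulAction.stabilizer G c : Subgroup G) : Set G) :=
      Subgroup.isOpen_mono (H₁ := O.left.sg.toSubgroup)
        (fun u hu => MulAction.mem_stabilizer_iff.mpr (hW₀ u hu)) O.left.sg.isOpen
    have hmem : ν ∈ Subgroup.centralizer ((MulAction.stabilizer G c : Subgroup G) : Set G) := by
      rw [Subgroup.mem_centralizer_iff]
      intro g hg
      exact hcomm g (MulAction.mem_stabilizer_iff.mp hg)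
    rw [hZ.centralizer_eq_bot _ hopen] at hmem
    exact Subgroup.mem_bot.mp hmem
  -- Step D: the component at `O` is the identity
  have hfixc : ∀ u ∈ (O.left : CosetCat G).sg,
      u • ((1 : G) : (⟨O.left.sg⟩ : CosetCat G).carrier) = ((1 : G) : (⟨O.left.sg⟩ : CosetCat G).carrier) :=
    fun u hu => by
      rw [smul_coe_eq_coe_iff, inv_one, one_mul, mul_one]
      exact hu
  let kl : O.left ⟶ (⟨O.left.sg⟩ : CosetCat G) := homMk ((1 : G) : (⟨O.left.sg⟩ : CosetCat G).carrier) hfixc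
  have hkw : kl ≫ (homMk c hW₀ : (⟨O.left.sg⟩ : CosetCat G) ⟶ A) = O.hom :=
    hom_ext (by rw [pt_comp, pt_homMk, homMk_toFun_coe, one_smul, hc])
  let k : O ⟶ Over.mk (homMk c hW₀ : (⟨O.left.sg⟩ : CosetCat G) ⟶ A) := Over.homMk kl hkw
  obtain ⟨m, hm⟩ := QuotientGroup.mk_surjective (pt (α.hom.app O))
  have h := forget_iso_relation α k 1 m (pt_homMk _ hfixc) hm.symm
  have h2 := mem_of_smul_eq_coe (hν O.left.sg hW₀) h
  simp only [hν1, mul_one] at h2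
  have h3 : ((m : G) : O.left.carrier) = ((1 : G) : O.left.carrier) :=
    QuotientGroup.eq.mpr (by rw [mul_one]; exact h2)
  apply hom_ext
  exact hm.symm.trans (h3.trans (pt_id _).symm)

/-- **Step A for a TEMPERED group** ([SemiAnbd] Def. 3.1 (i), Rmk. 3.4.1; [FrdI] §0 p. 14): for an automorphism `α`
of `(CosetCat Π)_A → CosetCat Π` and a point `c ∈ Π/U_A` whose stabiliser contains an open subgroup `W₀`, the classes
`α_{(Π/W, c)}(1·W)` (`W` open, `W ⊆ Stab(c)`) all come from ONE `ν ∈ Π`: the sub-family at the open NORMAL subgroups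
`N ∩ W₀` projects to a compatible family `(x_N ∈ Π/N)_N`, which is the family of classes of some `ν` since `Π = lim Π/N`
(`IsTempered.complete`); every open `W ⊆ Stab(c)` contains an open normal `N'` (`IsTempered.basis`), and the class at `W`
is the image of the class `ν N'` at `N'`. [cite: MochizukiSemiAnbd2006, Rmk 3.4.1 p.36] -/
theorem exists_lift_of_forget_iso_of_isTempered [IsTopologicalGroup G] (hG : IsTempered G) {A : CosetCat G}
    (α : Over.forget A ≅ Over.forget A) (c : A.carrier) (W₀ : OpenSubgroup G) (hW₀ : ∀ u ∈ W₀, u • c = c) :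
    ∃ ν : G, ∀ (W : OpenSubgroup G) (hW : ∀ u ∈ W, u • c = c),
      pt (α.hom.app (Over.mk (homMk c hW : (⟨W⟩ : CosetCat G) ⟶ A))) =
        ((ν : G) : (⟨W⟩ : CosetCat G).carrier) := by
  classical
  -- the class picked by `α` at `(Π/W, c)` for `W ⊆ Stab(c)` open
  let q : ∀ (W : OpenSubgroup G) (_ : ∀ u ∈ W, u • c = c), (⟨W⟩ : CosetCat G).carrier := fun W hW =>
    pt (α.hom.app (Over.mk (homMk c hW : (⟨W⟩ : CosetCat G) ⟶ A)))
  have hq_compat : ∀ (W W' : OpenSubgroup G) (hW : ∀ u ∈ W, u • c = c) (hW' : ∀ u ∈ W', u • c = c),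
      W ≤ W' → ∀ g : G, q W hW = ((g : G) : (⟨W⟩ : CosetCat G).carrier) →
        q W' hW' = ((g : G) : (⟨W'⟩ : CosetCat G).carrier) :=
    fun W W' hW hW' hle g hg => forget_iso_compat α c hW hW' hle g hg
  -- the open normal subgroups `N ∩ W₀`-indexed sub-family, projected to `Π/N`
  let WN : OpenNormalSubgroup G → OpenSubgroup G := fun N => N.toOpenSubgroup ⊓ W₀
  have hWN : ∀ N : OpenNormalSubgroup G, ∀ u ∈ WN N, u • c = c :=
    fun N u hu => hW₀ u (OpenSubgroup.mem_inf.mp hu).2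
  have hWN_le : ∀ N : OpenNormalSubgroup G, (WN N).toSubgroup ≤ N.toSubgroup :=
    fun N u hu => (OpenSubgroup.mem_inf.mp hu).1
  let x : ∀ N : OpenNormalSubgroup G, G ⧸ N.toSubgroup := fun N =>
    Subgroup.quotientMapOfLE (hWN_le N) (q (WN N) (hWN N))
  have hx : ∀ (N : OpenNormalSubgroup G) (g : G), q (WN N) (hWN N) = ((g : G) : (⟨WN N⟩ : CosetCat G).carrier) →
      x N = (g : G ⧸ N.toSubgroup) := fun N g hg => by
    change Subgroup.quotientMapOfLE _ (q (WN N) (hWN N)) = _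
    rw [hg]
    rfl
  have hcompat : ∀ N M : OpenNormalSubgroup G, N ≤ M → ∀ g : G,
      x N = (g : G ⧸ N.toSubgroup) → x M = (g : G ⧸ M.toSubgroup) := by
    intro N M hNM g hg
    -- representatives: `q (WN N) = n (WN N)` for some `n`; then `x N = n N = g N`, so `g⁻¹ n ∈ N`... we argue via `WN (N) ⊓ WN M`
    obtain ⟨n, hn⟩ := QuotientGroup.mk_surjective (q (WN N) (hWN N))
    have hxN : x N = (n : G ⧸ N.toSubgroup) := hx N n hn.symm
    have hle : WN N ≤ WN M := fun u hu =>
      OpenSubgroup.mem_inf.mpr ⟨hNM (OpenSubgroup.mem_inf.mp hu).1, (OpenSubgroup.mem_inf.mp hu).2⟩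
    have hqM : q (WN M) (hWN M) = ((n : G) : (⟨WN M⟩ : CosetCat G).carrier) :=
      hq_compat (WN N) (WN M) (hWN N) (hWN M) hle n hn.symm
    have hxM : x M = (n : G ⧸ M.toSubgroup) := hx M n hqM
    rw [hxM]
    rw [hxN] at hg
    -- `n N = g N` ⇒ `n M = g M` since `N ≤ M`
    have hng : n⁻¹ * g ∈ N.toSubgroup := QuotientGroup.eq.mp hg
    exact QuotientGroup.eq.mpr (hNM hng)
  obtain ⟨ν, hν⟩ := hG.complete x hcompat
  refine ⟨ν, fun W hW => ?_⟩
  -- an open normal `N' ⊆ W ∩ W₀`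
  obtain ⟨N', -, hN'⟩ := hG.basis ((W ⊓ W₀ : OpenSubgroup G) : Set G) ((W ⊓ W₀).isOpen.mem_nhds (one_mem _))
  have hN'W : ∀ u ∈ N'.toOpenSubgroup, u ∈ W := fun u hu => (OpenSubgroup.mem_inf.mp (hN' hu)).1
  have hN'W₀ : ∀ u ∈ N'.toOpenSubgroup, u ∈ W₀ := fun u hu => (OpenSubgroup.mem_inf.mp (hN' hu)).2
  -- `WN N' = N'` as open subgroups (since `N' ≤ W₀`)
  have hWN' : WN N' = N'.toOpenSubgroup :=
    le_antisymm (fun u hu => (OpenSubgroup.mem_inf.mp hu).1) fun u hu => OpenSubgroup.mem_inf.mpr ⟨hu, hN'W₀ u hu⟩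
  -- the class at `WN N'` is `ν · (WN N')`
  obtain ⟨n, hn⟩ := QuotientGroup.mk_surjective (q (WN N') (hWN N'))
  have hxN' : x N' = (n : G ⧸ N'.toSubgroup) := hx N' n hn.symm
  rw [hν N'] at hxN'
  have hνn : ν⁻¹ * n ∈ N'.toSubgroup := QuotientGroup.eq.mp hxN'
  have hqN' : q (WN N') (hWN N') = ((ν : G) : (⟨WN N'⟩ : CosetCat G).carrier) := by
    rw [← hn]
    apply QuotientGroup.eq.mpr
    change n⁻¹ * ν ∈ (WN N').toSubgroup
    rw [hWN']
    have := N'.toSubgroup.inv_mem hνn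
    rwa [mul_inv_rev, inv_inv] at this
  -- project from `WN N' ≤ W`
  have hle : WN N' ≤ W := fun u hu => hN'W u (by rw [← hWN']; exact hu)
  exact hq_compat (WN N') W (hWN N') hW hle ν hqN'

/-- **`CosetCat Π` is a slim category for `Π` tempered and temp-slim** ([SemiAnbd] Rmk. 3.4.1 "a temperoid is slim as a
category if and only if it is temp-slim", on the small coset model of `𝓑^temp(Π)⁰`; [FrdI] §0 p. 14): Step A by
`exists_lift_of_forget_iso_of_isTempered`, point separation by `IsTempered.separated`, Steps B–D by
`isSlim_of_forall_exists_lift`. [cite: MochizukiSemiAnbd2006, Rmk 3.4.1 p.36] -/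
theorem isSlim_of_isSlimGroup_of_isTempered [IsTopologicalGroup G] (hG : IsTempered G) (hZ : IsSlimGroup G) :
    IsSlim (CosetCat G) :=
  isSlim_of_forall_exists_lift
    (fun x hx => by
      obtain ⟨N, hN⟩ := hG.separated x hx
      exact ⟨N.toOpenSubgroup, hN⟩)
    hZ (fun α c W₀ hW₀ => exists_lift_of_forget_iso_of_isTempered hG α c W₀ hW₀)

end CosetCat

section ConnectedPart

open CategoryTheory Literature.AlgebraicGeometry.Frobenioids

universe u

variable {G : Type u} [Group G] [TopologicalSpace G] [IsTopologicalGroup G]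

/-- **`𝓑^temp(Π)⁰ = ConnectedPart (BTemp Π)` is a slim category for `Π` tempered and temp-slim** ([SemiAnbd] Rmk. 3.4.1;
[FrdI] §0 p. 14) — transported from the small coset model along abc-iut-L5-t2's equivalence
`CosetCat.equivConnectedPart : CosetCat Π ≌ ConnectedPart (BTemp Π)`. This is the hypothesis "`D` slim" of [EtTh]
Thm. 3.7 / Prop. 5.5 / Thm. 5.7 at the genuine base `D := B^temp(Π^tp_X)⁰`. [cite: MochizukiSemiAnbd2006, Rmk 3.4.1 p.36] -/
theorem isSlim_connectedPart_bTemp (hG : IsTempered G) (hZ : IsSlimGroup G) : IsSlim (ConnectedPart (BTemp G)) :=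
  (CosetCat.isSlim_of_isSlimGroup_of_isTempered hG hZ).of_equivalence (CosetCat.equivConnectedPart hG)

/-- **The genuine base `B^temp(Π^tp_X)⁰` of [EtTh] §3–§5 is slim** for abc-iut-L3-t2's tempered arithmetic fundamental
group `X` ([SemiAnbd] Ex. 3.10: `Π^tp_X` is tempered and temp-slim) — discharges the binder `hslim : IsSlim D` of the
tree's [EtTh] Thm. 3.7 / Thm. 5.7 files at `D := ConnectedPart (BTemp X.Pi)`.
[cite: MochizukiEtTh2009, Thm 3.7 p.303 (PDF p.77)] -/
theorem TemperedArithmeticGroup.isSlim_connectedPart {K : Type u} [Field K] (X : TemperedArithmeticGroup K) :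
    IsSlim (ConnectedPart (BTemp X.Pi)) :=
  isSlim_connectedPart_bTemp X.isTempered X.isSlimGroup

end ConnectedPart

end Literature.AnabelianGeometry.SemiGraphs
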